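import Literature.Topology.FourManifolds.PlumbingSphereGeometry
import HarnessLib

/-!
# The polar plumbing chart: base and fibre coordinates in which the plumbing map is the swap

Topic `Literature/Topology/FourManifolds`; companion of `PlumbingSphereGeometry.lean` for the
construction of Kosinski's plumbing `M(4m)` (A. Kosinski, *Differential Manifolds* (1993),
VI.12). For a pole `e ∈ Sᵏ` every point `(p, q)` of the plumbing domain
`D_e(c) = {⟪p, e⟫ > c, ⟪p, q⟫ > c}` (`c ≥ 0`) has

* a **base coordinate** `x = P_e p = p - ⟪p, e⟫ e ∈ e^⊥`, with `‖x‖² = 1 - ⟪p, e⟫²`, and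
* a **fibre coordinate** `y = P_e (rotTo p e q) ∈ e^⊥`, with `‖y‖² = 1 - ⟪p, q⟫²`,

(`Plumbing.kap e (p, q) = (x, y)`), and `(x, y)` ranges over `B × B`, `B` the open ball of radius
`√(1 - c²)` in the hyperplane `e^⊥`; the inverse is `p = x + √(1 - ‖x‖²) e`,
`q = rotFrom p e (y + √(1 - ‖y‖²) e)` (`Plumbing.unkap`). **In these coordinates the plumbing
involution `plumbMap e` of `PlumbingSphereGeometry.lean` is Kosinski's swap `(x, y) ↦ (y, x)`**
(`kap_plumbMap`, an identity valid on all of `Sᵏ × Sᵏ`): VI.12 p. 120, "identify `D₁ᵏ × Dᵏ`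
with `Dᵏ × D₂ᵏ` by `(x, y) ↦ (y, x)`". Everything is proved; no named facts.

## References

* A. Kosinski, *Differential Manifolds*, Academic Press 1993, VI.12 p. 120. [Kosinski1993]
-/

open scoped Manifold ContDiff Topology RealInnerProductSpace
open Set Function Module

noncomputable section

namespace Literature.Topology.FourManifolds

namespace Plumbing

section InnerProductSpace

variable {E : Type*} [NormedAddCommGroup E] [InnerProductSpace ℝ E]

/-! ### §1 Projection to the hyperplane `e^⊥` -/

/-- The orthogonal projection to `e^⊥` (for a unit vector `e`): `P_e p = p - ⟪p, e⟫ e`. [folklore] -/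
def perp (e p : E) : E := p - ⟪p, e⟫ • e

/-- `perp_apply` (perp apply). [folklore] -/
theorem perp_apply (e p : E) : perp e p = p - ⟪p, e⟫ • e := rfl

/-- `inner_perp_left` (inner perp left). [folklore] -/
theorem inner_perp_left {e : E} (he : ‖e‖ = 1) (p : E) : ⟪perp e p, e⟫ = 0 := by
  rw [perp, inner_sub_left, real_inner_smul_left, real_inner_self_eq_norm_sq, he]; ring

/-- `inner_perp_right` (inner perp right). [folklore] -/
theorem inner_perp_right {e : E} (he : ‖e‖ = 1) (p : E) : ⟪e, perp e p⟫ = 0 := by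
  rw [real_inner_comm]; exact inner_perp_left he p

/-- `‖P_e p‖² = ‖p‖² - ⟪p, e⟫²`. [folklore] -/
theorem norm_perp_sq {e : E} (he : ‖e‖ = 1) (p : E) : ‖perp e p‖ ^ 2 = ‖p‖ ^ 2 - ⟪p, e⟫ ^ 2 := by
  rw [← real_inner_self_eq_norm_sq, ← real_inner_self_eq_norm_sq, perp]
  have hee : ⟪e, e⟫ = 1 := by rw [real_inner_self_eq_norm_sq, he, one_pow]
  simp only [inner_sub_left, inner_sub_right, real_inner_smul_left, real_inner_smul_right, hee,
    real_inner_comm e p]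
  ring

/-- `p = P_e p + ⟪p, e⟫ e`. [folklore] -/
theorem perp_add_smul (e p : E) : perp e p + ⟪p, e⟫ • e = p := by rw [perp]; abel

/-- `perp_of_inner_eq_zero` (perp of inner eq zero). [folklore] -/
theorem perp_of_inner_eq_zero {e x : E} (h : ⟪x, e⟫ = 0) : perp e x = x := by
  rw [perp, h, zero_smul, sub_zero]

/-- `P_e (x + t e) = x` for `x ⊥ e`. [folklore] -/
theorem perp_add_smul_of_inner_eq_zero {e x : E} (he : ‖e‖ = 1) (h : ⟪x, e⟫ = 0) (t : ℝ) :
    perp e (x + t • e) = x := by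
  rw [perp, inner_add_left, real_inner_smul_left, real_inner_self_eq_norm_sq, he, h]
  simp

/-- `continuous_perp` (continuous perp). [folklore] -/
theorem continuous_perp (e : E) : Continuous (perp e) := by unfold perp; fun_prop

/-- `contDiff_perp` (contDiff perp). [folklore] -/
theorem contDiff_perp (e : E) {n : WithTop ℕ∞} : ContDiff ℝ n (perp e) := by
  unfold perp
  exact contDiff_id.sub ((contDiff_id.inner ℝ contDiff_const).smul contDiff_const)

/-! ### §2 Lifting a point of the ball of `e^⊥` to the cap of the sphere -/

/-- The lift `x ↦ x + √(1 - ‖x‖²) e` of a point of the unit ball of `e^⊥` to the open hemisphere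
around `e`. [folklore] -/
def capLift (e x : E) : E := x + Real.sqrt (1 - ‖x‖ ^ 2) • e

/-- `capLift_apply` (capLift apply). [folklore] -/
theorem capLift_apply (e x : E) : capLift e x = x + Real.sqrt (1 - ‖x‖ ^ 2) • e := rfl

/-- The lift has norm one (`x ⊥ e`, `‖x‖ ≤ 1`). [folklore] -/
theorem norm_capLift {e x : E} (he : ‖e‖ = 1) (h : ⟪x, e⟫ = 0) (hx : ‖x‖ ≤ 1) : ‖capLift e x‖ = 1 := by
  have h1 : ‖capLift e x‖ ^ 2 = 1 := by
    rw [← real_inner_self_eq_norm_sq, capLift]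
    have hee : ⟪e, e⟫ = 1 := by rw [real_inner_self_eq_norm_sq, he, one_pow]
    have hxe : ⟪e, x⟫ = 0 := by rw [real_inner_comm]; exact h
    have hxx : ⟪x, x⟫ = ‖x‖ ^ 2 := real_inner_self_eq_norm_sq x
    simp only [inner_add_left, inner_add_right, real_inner_smul_left, real_inner_smul_right, hee, h, hxe, hxx]
    have hs : Real.sqrt (1 - ‖x‖ ^ 2) * Real.sqrt (1 - ‖x‖ ^ 2) = 1 - ‖x‖ ^ 2 :=
      Real.mul_self_sqrt (by nlinarith [norm_nonneg x])
    nlinarith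
  exact (pow_eq_one_iff_of_nonneg (norm_nonneg _) two_ne_zero).1 h1

/-- The height of the lift: `⟪capLift e x, e⟫ = √(1 - ‖x‖²)` (`x ⊥ e`). [folklore] -/
theorem inner_capLift {e x : E} (he : ‖e‖ = 1) (h : ⟪x, e⟫ = 0) : ⟪capLift e x, e⟫ = Real.sqrt (1 - ‖x‖ ^ 2) := by
  rw [capLift, inner_add_left, h, real_inner_smul_left, real_inner_self_eq_norm_sq, he]; ring

/-- The projection of the lift is the point: `P_e (capLift e x) = x` (`x ⊥ e`). [folklore] -/
theorem perp_capLift {e x : E} (he : ‖e‖ = 1) (h : ⟪x, e⟫ = 0) : perp e (capLift e x) = x :=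
  perp_add_smul_of_inner_eq_zero he h _

/-- The lift of the projection is the point, on the open hemisphere: `capLift e (P_e p) = p` for
`‖p‖ = 1`, `⟪p, e⟫ ≥ 0`. [folklore] -/
theorem capLift_perp {e p : E} (he : ‖e‖ = 1) (hp : ‖p‖ = 1) (h : 0 ≤ ⟪p, e⟫) : capLift e (perp e p) = p := by
  rw [capLift, norm_perp_sq he, hp, one_pow]
  have : Real.sqrt (1 - (1 - ⟪p, e⟫ ^ 2)) = ⟪p, e⟫ := by
    rw [show (1 : ℝ) - (1 - ⟪p, e⟫ ^ 2) = ⟪p, e⟫ ^ 2 by ring, Real.sqrt_sq h]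
  rw [this, perp_add_smul]

/-- `continuous_capLift` (continuous capLift). [folklore] -/
theorem continuous_capLift (e : E) : Continuous (capLift e) := by unfold capLift; fun_prop

/-- The lift is smooth on the open unit ball (where `1 - ‖x‖² > 0`). [folklore] -/
theorem contDiffAt_capLift (e : E) {n : WithTop ℕ∞} {x : E} (hx : ‖x‖ < 1) : ContDiffAt ℝ n (capLift e) x := by
  unfold capLift
  refine contDiffAt_id.add (ContDiffAt.smul ?_ contDiffAt_const)
  have h : 0 < 1 - ‖x‖ ^ 2 := by nlinarith [norm_nonneg x]
  exact (contDiffAt_const.sub (contDiff_norm_sq ℝ).contDiffAt).sqrt h.ne'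

end InnerProductSpace

/-! ### §3 The polar plumbing chart of `Sᵏ × Sᵏ` -/

section Sphere

/-- Local notation: `𝔼 n` is the model Euclidean space `EuclideanSpace ℝ (Fin n)`. -/
local notation "𝔼 " n:arg => EuclideanSpace ℝ (Fin n)

/-- Local notation: `𝕊 n` is the unit sphere in `EuclideanSpace ℝ (Fin (n + 1))`. -/
local notation "𝕊 " n:arg => (Metric.sphere (0 : EuclideanSpace ℝ (Fin (n + 1))) 1)

variable {k : ℕ}

/-- **The base coordinate** `x = P_e p` of a point of `Sᵏ × Sᵏ`. [cite: Kosinski1993, VI.12 p. 120] -/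
def kapFst (e : 𝕊 k) (pq : (𝕊 k) × (𝕊 k)) : 𝔼 (k + 1) := perp (e : 𝔼 (k + 1)) (pq.1 : 𝔼 (k + 1))

/-- **The fibre coordinate** `y = P_e (rotTo p e q)` of a point of `Sᵏ × Sᵏ`. [cite: Kosinski1993, VI.12 p. 120] -/
def kapSnd (e : 𝕊 k) (pq : (𝕊 k) × (𝕊 k)) : 𝔼 (k + 1) :=
  perp (e : 𝔼 (k + 1)) (rotTo (pq.1 : 𝔼 (k + 1)) e pq.2)

/-- **The polar plumbing chart** `κ_e(p, q) = (P_e p, P_e (rotTo p e q))`. [cite: Kosinski1993, VI.12 p. 120] -/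
def kap (e : 𝕊 k) (pq : (𝕊 k) × (𝕊 k)) : 𝔼 (k + 1) × 𝔼 (k + 1) := (kapFst e pq, kapSnd e pq)

/-- `kap_fst` (kap fst). [folklore] -/
@[simp] theorem kap_fst (e : 𝕊 k) (pq : (𝕊 k) × (𝕊 k)) : (kap e pq).1 = kapFst e pq := rfl
/-- `kap_snd` (kap snd). [folklore] -/
@[simp] theorem kap_snd (e : 𝕊 k) (pq : (𝕊 k) × (𝕊 k)) : (kap e pq).2 = kapSnd e pq := rfl

/-- **The plumbing map is the swap in the polar chart**: `κ_e (plumbMap e (p, q)) = (y, x)` — on all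
of `Sᵏ × Sᵏ` (`rotTo p' e (rotFrom p' e p) = p`). [cite: Kosinski1993, VI.12 p. 120] -/
theorem kap_plumbMap (e : 𝕊 k) (pq : (𝕊 k) × (𝕊 k)) : kap e (plumbMap e pq) = (kap e pq).swap := by
  refine Prod.ext ?_ ?_
  · rfl
  · change perp (e : 𝔼 (k + 1)) (rotTo (plumbFst e pq : 𝔼 (k + 1)) e (plumbSnd e pq : 𝔼 (k + 1))) =
      perp (e : 𝔼 (k + 1)) (pq.1 : 𝔼 (k + 1))
    rw [coe_plumbSnd, rotTo_rotFrom]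

/-- `inner_kapFst_pole` (inner kapFst pole). [folklore] -/
theorem inner_kapFst_pole (e : 𝕊 k) (pq : (𝕊 k) × (𝕊 k)) : ⟪kapFst e pq, (e : 𝔼 (k + 1))⟫ = 0 :=
  inner_perp_left (norm_eq_of_mem_sphere e) _

/-- `inner_kapSnd_pole` (inner kapSnd pole). [folklore] -/
theorem inner_kapSnd_pole (e : 𝕊 k) (pq : (𝕊 k) × (𝕊 k)) : ⟪kapSnd e pq, (e : 𝔼 (k + 1))⟫ = 0 :=
  inner_perp_left (norm_eq_of_mem_sphere e) _

/-- `‖x‖² = 1 - ⟪p, e⟫²` (the squared base radius `a_e`). [folklore] -/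
theorem norm_kapFst_sq (e : 𝕊 k) (pq : (𝕊 k) × (𝕊 k)) : ‖kapFst e pq‖ ^ 2 = 1 - baseHt e pq ^ 2 := by
  rw [kapFst, norm_perp_sq (norm_eq_of_mem_sphere e), norm_eq_of_mem_sphere pq.1, one_pow, baseHt_apply]

/-- `‖y‖² = 1 - ⟪p, q⟫²` (the squared fibre radius `b`), for `p ≠ -e`. [folklore] -/
theorem norm_kapSnd_sq (e : 𝕊 k) {pq : (𝕊 k) × (𝕊 k)} (h : -1 < baseHt e pq) :
    ‖kapSnd e pq‖ ^ 2 = 1 - fibHt pq ^ 2 := by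
  rw [kapSnd, norm_perp_sq (norm_eq_of_mem_sphere e), norm_rotTo, norm_eq_of_mem_sphere pq.2, one_pow]
  have := inner_plumbFst_pole e h
  rw [coe_plumbFst] at this
  rw [this, fibHt_apply]

/-- The base coordinate lies in the open unit ball when `⟪p, e⟫ ≠ 0`, and `‖x‖² < 1 - c²` on the cap
`⟪p, e⟫ > c ≥ 0`. [folklore] -/
theorem norm_kapFst_sq_lt (e : 𝕊 k) {pq : (𝕊 k) × (𝕊 k)} {c : ℝ} (hc : 0 ≤ c) (h : c < baseHt e pq) :
    ‖kapFst e pq‖ ^ 2 < 1 - c ^ 2 := by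
  rw [norm_kapFst_sq]; nlinarith

/-- `norm_kapSnd_sq_lt` (norm kapSnd sq lt). [folklore] -/
theorem norm_kapSnd_sq_lt (e : 𝕊 k) {pq : (𝕊 k) × (𝕊 k)} {c : ℝ} (hc : 0 ≤ c) (hb : -1 < baseHt e pq)
    (h : c < fibHt pq) : ‖kapSnd e pq‖ ^ 2 < 1 - c ^ 2 := by
  rw [norm_kapSnd_sq e hb]; nlinarith

/-- The chart is continuous at every point with `p ≠ -e`. [folklore] -/
theorem continuousAt_kap (e : 𝕊 k) {pq : (𝕊 k) × (𝕊 k)} (h : -1 < baseHt e pq) : ContinuousAt (kap e) pq := by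
  refine ContinuousAt.prodMk ?_ ?_
  · exact ((continuous_perp _).comp (continuous_subtype_val.comp continuous_fst)).continuousAt
  · exact (continuous_perp _).continuousAt.comp (contMDiffAt_coe_plumbFst e h).continuousAt

/-- `continuousOn_kap` (continuousOn kap). [folklore] -/
theorem continuousOn_kap (e : 𝕊 k) : ContinuousOn (kap e) {pq | -1 < baseHt e pq} :=
  fun _ hpq => (continuousAt_kap e hpq).continuousWithinAt

/-! #### The inverse chart -/

/-- **The inverse chart**: `(x, y) ↦ (p, q)`, `p = x + √(1 - ‖x‖²) e`, `q = rotFrom p e (y + √(1 - ‖y‖²) e)`,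
as vectors of `ℝᵏ⁺¹`. [cite: Kosinski1993, VI.12 p. 120] -/
def unkapVec (e : 𝕊 k) (xy : 𝔼 (k + 1) × 𝔼 (k + 1)) : 𝔼 (k + 1) × 𝔼 (k + 1) :=
  (capLift (e : 𝔼 (k + 1)) xy.1, rotFrom (capLift (e : 𝔼 (k + 1)) xy.1) e (capLift (e : 𝔼 (k + 1)) xy.2))

variable (k) in
/-- The good set of coordinates: `x, y ⊥ e` in the open unit ball of `e^⊥`. [folklore] -/
def kapTarget (e : 𝕊 k) (r : ℝ) : Set (𝔼 (k + 1) × 𝔼 (k + 1)) :=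
  {xy | ⟪xy.1, (e : 𝔼 (k + 1))⟫ = 0 ∧ ⟪xy.2, (e : 𝔼 (k + 1))⟫ = 0 ∧ ‖xy.1‖ < r ∧ ‖xy.2‖ < r}

/-- `mem_kapTarget` (mem kapTarget). [folklore] -/
theorem mem_kapTarget {e : 𝕊 k} {r : ℝ} {xy : 𝔼 (k + 1) × 𝔼 (k + 1)} :
    xy ∈ kapTarget k e r ↔ ⟪xy.1, (e : 𝔼 (k + 1))⟫ = 0 ∧ ⟪xy.2, (e : 𝔼 (k + 1))⟫ = 0 ∧ ‖xy.1‖ < r ∧ ‖xy.2‖ < r :=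
  Iff.rfl

/-- On good coordinates (`r ≤ 1`) both lifted vectors are unit vectors. [folklore] -/
theorem norm_unkapVec_fst {e : 𝕊 k} {r : ℝ} (hr : r ≤ 1) {xy : 𝔼 (k + 1) × 𝔼 (k + 1)} (h : xy ∈ kapTarget k e r) :
    ‖(unkapVec e xy).1‖ = 1 :=
  norm_capLift (norm_eq_of_mem_sphere e) h.1 (h.2.2.1.le.trans hr)

/-- `norm_unkapVec_snd` (norm unkapVec snd). [folklore] -/
theorem norm_unkapVec_snd {e : 𝕊 k} {r : ℝ} (hr : r ≤ 1) {xy : 𝔼 (k + 1) × 𝔼 (k + 1)} (h : xy ∈ kapTarget k e r) :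
    ‖(unkapVec e xy).2‖ = 1 := by
  rw [unkapVec, norm_rotFrom]
  exact norm_capLift (norm_eq_of_mem_sphere e) h.2.1 (h.2.2.2.le.trans hr)

/-- **The inverse chart** as a map into `Sᵏ × Sᵏ`, on good coordinates. [cite: Kosinski1993, VI.12 p. 120] -/
def unkap (e : 𝕊 k) {r : ℝ} (hr : r ≤ 1) (xy : ↥(kapTarget k e r)) : (𝕊 k) × (𝕊 k) :=
  (⟨(unkapVec e xy.1).1, by rw [mem_sphere_zero_iff_norm]; exact norm_unkapVec_fst hr xy.2⟩,
   ⟨(unkapVec e xy.1).2, by rw [mem_sphere_zero_iff_norm]; exact norm_unkapVec_snd hr xy.2⟩)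

/-- `coe_unkap_fst` (coe unkap fst). [folklore] -/
theorem coe_unkap_fst (e : 𝕊 k) {r : ℝ} (hr : r ≤ 1) (xy : ↥(kapTarget k e r)) :
    ((unkap e hr xy).1 : 𝔼 (k + 1)) = capLift (e : 𝔼 (k + 1)) xy.1.1 := rfl

/-- `coe_unkap_snd` (coe unkap snd). [folklore] -/
theorem coe_unkap_snd (e : 𝕊 k) {r : ℝ} (hr : r ≤ 1) (xy : ↥(kapTarget k e r)) :
    ((unkap e hr xy).2 : 𝔼 (k + 1)) =
      rotFrom (capLift (e : 𝔼 (k + 1)) xy.1.1) e (capLift (e : 𝔼 (k + 1)) xy.1.2) := rfl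

/-- The base height of the inverse chart: `⟪p, e⟫ = √(1 - ‖x‖²) > 0`. [folklore] -/
theorem baseHt_unkap (e : 𝕊 k) {r : ℝ} (hr : r ≤ 1) (xy : ↥(kapTarget k e r)) :
    baseHt e (unkap e hr xy) = Real.sqrt (1 - ‖xy.1.1‖ ^ 2) := by
  rw [baseHt_apply, coe_unkap_fst, inner_capLift (norm_eq_of_mem_sphere e) xy.2.1]

/-- `baseHt_unkap_pos` (baseHt unkap pos). [folklore] -/
theorem baseHt_unkap_pos (e : 𝕊 k) {r : ℝ} (hr : r ≤ 1) (xy : ↥(kapTarget k e r)) : 0 < baseHt e (unkap e hr xy) := by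
  rw [baseHt_unkap]
  apply Real.sqrt_pos.2
  have := xy.2.2.2.1
  nlinarith [norm_nonneg xy.1.1]

/-- The fibre height of the inverse chart: `⟪p, q⟫ = √(1 - ‖y‖²) > 0`. [folklore] -/
theorem fibHt_unkap (e : 𝕊 k) {r : ℝ} (hr : r ≤ 1) (xy : ↥(kapTarget k e r)) :
    fibHt (unkap e hr xy) = Real.sqrt (1 - ‖xy.1.2‖ ^ 2) := by
  have he := norm_eq_of_mem_sphere e
  have hp : ‖capLift (e : 𝔼 (k + 1)) xy.1.1‖ = 1 := norm_capLift he xy.2.1 (xy.2.2.2.1.le.trans hr)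
  have h0 : capLift (e : 𝔼 (k + 1)) xy.1.1 + (e : 𝔼 (k + 1)) ≠ 0 := by
    apply add_ne_zero_of_neg_one_lt_inner he
    rw [inner_capLift he xy.2.1]
    have := Real.sqrt_nonneg (1 - ‖xy.1.1‖ ^ 2); linarith
  rw [fibHt_apply, coe_unkap_fst, coe_unkap_snd]
  set p := capLift (e : 𝔼 (k + 1)) xy.1.1 with hpdef
  calc ⟪p, rotFrom p e (capLift (e : 𝔼 (k + 1)) xy.1.2)⟫
        = ⟪rotTo p e p, rotTo p e (rotFrom p e (capLift (e : 𝔼 (k + 1)) xy.1.2))⟫ :=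
          (inner_rotTo_rotTo _ _ _ _).symm
    _ = ⟪(e : 𝔼 (k + 1)), capLift (e : 𝔼 (k + 1)) xy.1.2⟫ := by
          rw [rotTo_self (by rw [hp, he]) h0, rotTo_rotFrom]
    _ = Real.sqrt (1 - ‖xy.1.2‖ ^ 2) := by rw [real_inner_comm, inner_capLift he xy.2.2.1]

/-- `fibHt_unkap_pos` (fibHt unkap pos). [folklore] -/
theorem fibHt_unkap_pos (e : 𝕊 k) {r : ℝ} (hr : r ≤ 1) (xy : ↥(kapTarget k e r)) : 0 < fibHt (unkap e hr xy) := by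
  rw [fibHt_unkap]
  apply Real.sqrt_pos.2
  have := xy.2.2.2.2
  nlinarith [norm_nonneg xy.1.2]

/-- **`κ_e ∘ κ_e⁻¹ = id`** on good coordinates. [folklore] -/
theorem kap_unkap (e : 𝕊 k) {r : ℝ} (hr : r ≤ 1) (xy : ↥(kapTarget k e r)) : kap e (unkap e hr xy) = xy.1 := by
  have he := norm_eq_of_mem_sphere e
  have hp : ‖capLift (e : 𝔼 (k + 1)) xy.1.1‖ = 1 := norm_capLift he xy.2.1 (xy.2.2.2.1.le.trans hr)
  have h0 : capLift (e : 𝔼 (k + 1)) xy.1.1 + (e : 𝔼 (k + 1)) ≠ 0 := by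
    apply add_ne_zero_of_neg_one_lt_inner he
    rw [inner_capLift he xy.2.1]
    have := Real.sqrt_nonneg (1 - ‖xy.1.1‖ ^ 2); linarith
  refine Prod.ext ?_ ?_
  · change perp (e : 𝔼 (k + 1)) (capLift (e : 𝔼 (k + 1)) xy.1.1) = xy.1.1
    exact perp_capLift he xy.2.1
  · change perp (e : 𝔼 (k + 1)) (rotTo (capLift (e : 𝔼 (k + 1)) xy.1.1) e
      (rotFrom (capLift (e : 𝔼 (k + 1)) xy.1.1) e (capLift (e : 𝔼 (k + 1)) xy.1.2))) = xy.1.2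
    rw [rotTo_rotFrom]
    exact perp_capLift he xy.2.2.1

/-- The chart maps the plumbing domain `D_e(c)` (`0 ≤ c`) into the good coordinates of radius
`√(1 - c²)`. [folklore] -/
theorem kap_mem_kapTarget (e : 𝕊 k) {c : ℝ} (hc : 0 ≤ c) {pq : (𝕊 k) × (𝕊 k)} (h : pq ∈ plumbDom e c) :
    kap e pq ∈ kapTarget k e (Real.sqrt (1 - c ^ 2)) := by
  have hb : -1 < baseHt e pq := by linarith [h.1]
  refine ⟨inner_kapFst_pole e pq, inner_kapSnd_pole e pq, ?_, ?_⟩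
  · change ‖kapFst e pq‖ < _
    rw [← Real.sqrt_sq (norm_nonneg (kapFst e pq))]
    exact Real.sqrt_lt_sqrt (sq_nonneg _) (norm_kapFst_sq_lt e hc h.1)
  · change ‖kapSnd e pq‖ < _
    rw [← Real.sqrt_sq (norm_nonneg (kapSnd e pq))]
    exact Real.sqrt_lt_sqrt (sq_nonneg _) (norm_kapSnd_sq_lt e hc hb h.2)

/-- `sqrt_one_sub_sq_le_one` (sqrt one sub sq le one). [folklore] -/
theorem sqrt_one_sub_sq_le_one (c : ℝ) : Real.sqrt (1 - c ^ 2) ≤ 1 := by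
  rw [Real.sqrt_le_one]; nlinarith

/-- **`κ_e⁻¹ ∘ κ_e = id`** on the plumbing domain `D_e(c)`, `c ≥ 0`. [folklore] -/
theorem unkap_kap (e : 𝕊 k) {c : ℝ} (hc : 0 ≤ c) {pq : (𝕊 k) × (𝕊 k)} (h : pq ∈ plumbDom e c) :
    unkap e (sqrt_one_sub_sq_le_one c) ⟨kap e pq, kap_mem_kapTarget e hc h⟩ = pq := by
  have he := norm_eq_of_mem_sphere e
  have hb : -1 < baseHt e pq := by linarith [h.1]
  have hpe : ‖(pq.1 : 𝔼 (k + 1))‖ = ‖(e : 𝔼 (k + 1))‖ := by rw [norm_eq_of_mem_sphere pq.1, he]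
  have h0 := add_ne_zero_of_neg_one_lt_inner he hb
  -- the first component
  have h1 : capLift (e : 𝔼 (k + 1)) (kapFst e pq) = (pq.1 : 𝔼 (k + 1)) :=
    capLift_perp he (norm_eq_of_mem_sphere pq.1) (hc.trans h.1.le)
  refine Prod.ext (Subtype.ext h1) (Subtype.ext ?_)
  change rotFrom (capLift (e : 𝔼 (k + 1)) (kapFst e pq)) e (capLift (e : 𝔼 (k + 1)) (kapSnd e pq)) = (pq.2 : 𝔼 (k + 1))
  rw [h1]
  -- the second: `capLift (P_e (rotTo p e q)) = rotTo p e q` since `⟪rotTo p e q, e⟫ = ⟪q, p⟫ ≥ 0`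
  have h2 : capLift (e : 𝔼 (k + 1)) (kapSnd e pq) = rotTo (pq.1 : 𝔼 (k + 1)) e pq.2 := by
    apply capLift_perp he
    · rw [norm_rotTo, norm_eq_of_mem_sphere pq.2]
    · have := inner_plumbFst_pole e hb
      rw [coe_plumbFst] at this
      rw [this, ← fibHt_apply]; exact hc.trans h.2.le
  rw [h2, rotFrom_rotTo]

/-- The inverse chart is continuous (on good coordinates, `r ≤ 1`). [folklore] -/
theorem continuous_unkap (e : 𝕊 k) {r : ℝ} (hr : r ≤ 1) : Continuous (unkap e hr) := by
  have he := norm_eq_of_mem_sphere e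
  have hF : Continuous fun xy : ↥(kapTarget k e r) => capLift (e : 𝔼 (k + 1)) xy.1.1 :=
    (continuous_capLift _).comp (continuous_fst.comp continuous_subtype_val)
  have hS : Continuous fun xy : ↥(kapTarget k e r) => capLift (e : 𝔼 (k + 1)) xy.1.2 :=
    (continuous_capLift _).comp (continuous_snd.comp continuous_subtype_val)
  refine Continuous.prodMk (hF.subtype_mk _) (Continuous.subtype_mk ?_ _)
  -- `rotFrom p e u` is continuous in `(p, u)` where `p + e ≠ 0`
  have hgood : ∀ xy : ↥(kapTarget k e r), capLift (e : 𝔼 (k + 1)) xy.1.1 + (e : 𝔼 (k + 1)) ≠ 0 := by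
    intro xy
    apply add_ne_zero_of_neg_one_lt_inner he
    rw [inner_capLift he xy.2.1]
    have := Real.sqrt_nonneg (1 - ‖xy.1.1‖ ^ 2); linarith
  rw [continuous_iff_continuousAt]
  intro xy
  have h := (contDiffAt_rotFrom (n := 0)
    (y := (capLift (e : 𝔼 (k + 1)) xy.1.1, capLift (e : 𝔼 (k + 1)) xy.1.2))
    contDiffAt_fst contDiffAt_const contDiffAt_snd (hgood xy) (coe_sphere_ne_zero e)).continuousAt
  exact ContinuousAt.comp (f := fun xy : ↥(kapTarget k e r) => (capLift (e : 𝔼 (k + 1)) xy.1.1, capLift (e : 𝔼 (k + 1)) xy.1.2))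
    (x := xy) h (hF.prodMk hS).continuousAt

/-- The inverse chart lands in the plumbing domain `D_e(c)` for coordinates of radius `√(1 - c²)`,
`0 ≤ c < 1`. [folklore] -/
theorem unkap_mem_plumbDom (e : 𝕊 k) {c : ℝ} (hc : 0 ≤ c) (hc1 : c < 1)
    (xy : ↥(kapTarget k e (Real.sqrt (1 - c ^ 2)))) : unkap e (sqrt_one_sub_sq_le_one c) xy ∈ plumbDom e c := by
  have hx := xy.2.2.2.1
  have hy := xy.2.2.2.2
  have hlt : ∀ t : ℝ, 0 ≤ t → t < Real.sqrt (1 - c ^ 2) → c < Real.sqrt (1 - t ^ 2) := by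
    intro t ht0 ht
    have h1 : t ^ 2 < 1 - c ^ 2 := by
      have := Real.sq_sqrt (show 0 ≤ 1 - c ^ 2 by nlinarith)
      nlinarith [Real.sqrt_nonneg (1 - c ^ 2)]
    calc c = Real.sqrt (c ^ 2) := (Real.sqrt_sq hc).symm
      _ < Real.sqrt (1 - t ^ 2) := Real.sqrt_lt_sqrt (sq_nonneg _) (by linarith)
  refine ⟨?_, ?_⟩
  · rw [baseHt_unkap]; exact hlt _ (norm_nonneg _) hx
  · rw [fibHt_unkap]; exact hlt _ (norm_nonneg _) hy

end Sphere

end Plumbing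

end Literature.Topology.FourManifolds
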